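import Mathlib
import Literature.AlgebraicGeometry.Tropical.InitialIdeal
import Literature.AlgebraicGeometry.Tropical.TropicalLink
import Summits.ResolutionOfSingularities.ResolutionOfSingularities.Theorems.TropicalLinksSchonResolvesRayChartRegular
import Summits.ResolutionOfSingularities.ResolutionOfSingularities.Theorems.TropicalLinksSchonResolvesGrobnerFamilyFibre
import Summits.ResolutionOfSingularities.ResolutionOfSingularities.Theorems.TropicalLinksSchonResolvesQuotientMapInr
import Summits.ResolutionOfSingularities.ResolutionOfSingularities.Theorems.TropicalLinksSchonResolvesHypersurfaceSectionDim
import Summits.ResolutionOfSingularities.ResolutionOfSingularities.Theorems.TropicalLinksSchonResolvesLaurentDim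
import Summits.ResolutionOfSingularities.ResolutionOfSingularities.Theorems.TropicalLinksSchonResolvesAwayDim

/-!
# TropicalLinks / SchonResolves — the dimension of an initial degeneration equals the dimension
# of the variety (Gröbner degeneration as a flat family, assembled)

Route `ResolutionOfSingularities/TropicalLinks`, crux `SchonResolves` (stmt-ResolutionOfSingularities-17234),
seed line `zariski-toric-closure`, brick DIM (registered stub
`schonResolves_ringKrullDim_quotient_weightInitialIdeal`): for a PRIME ideal `I` of the Laurent
polynomial ring `k[ℤ^n]` over a field with `dim k[ℤ^n] ⧸ I = d` and a weight `w ∈ ℤ^n` on the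
tropical variety (`in_w(I) ≠ ⊤`), the initial degeneration has the same dimension:
`dim k[ℤ^n] ⧸ in_w(I) = d` (Maclagan–Sturmfels, *Introduction to Tropical Geometry*, Lemma 3.2.? /
Cor. 3.2.?: "Gröbner degenerations are flat, so `dim in_w(X) = dim X`"; here as pure commutative
algebra). It is the dimension input of the chart-regularity induction of the line (the boundary
divisor of a partial compactification has no component in a codimension-two stratum) and of the
sister crux InductiveStep ("links have dimension `d − dim σ`").

Proof (no new definitions). The GRÖBNER FAMILY `t ↦ t^{-w}·V(I)` is realised as the partial
compactification along `t` of the sheared extension `Ĩ := ψ_w(I·k[t^±])` of `I` to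
`k[ℤ × ℤ^n] = k[t^±][x^±]`, `ψ_w(a,u) = (a + ⟨w,u⟩, u)`: its total space
`A_t := k[ℕ × ℤ^n] ⧸ (Ĩ ∩ k[ℕ × ℤ^n])` is an affine domain whose localization away from `t̄` is
`k[ℤ × ℤ^n] ⧸ Ĩ ≅ (k[ℤ^n] ⧸ I)[t^±]` (DIM-2 `schonResolves_quotient_map_inr_algEquiv`, p168668), of
dimension `d + 1` (`schonResolves_ringKrullDim_laurent_of_finiteType`, p168983;
`schonResolves_ringKrullDim_away_eq_of_finiteType`, p169113;
`schonResolves_isLocalization_away_quotient`, p167984), and whose special fibre `A_t ⧸ (t̄)` is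
`k[ℤ^n] ⧸ in_w(I)` (DIM-1 `schonResolves_grobnerFamily_fibreIdeal_eq_initialIdeal`, p167900, with
`schonResolves_nonempty_quotient_sup_span_ringEquiv`); a hypersurface section of an affine domain
drops the dimension by exactly one (`schonResolves_ringKrullDim_quotient_span_singleton_of_isDomain`,
p168871).

References: D. Maclagan, B. Sturmfels, *Introduction to Tropical Geometry* (2015), §2.4–§3.2
[MaclaganSturmfels2015]; D. Eisenbud, *Commutative Algebra*, Thm 15.17 (Gröbner degenerations are
flat) [Eisenbud1995].
-/

-- single-problem summit: the doubled namespace component `ResolutionOfSingularities` is forced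
set_option linter.dupNamespace false

namespace Summit.ResolutionOfSingularities.ResolutionOfSingularities.Theorems

open AddMonoidAlgebra Literature.AlgebraicGeometry.Tropical

/-- The quotient of `A ⧸ I` by the class of `x` is `A ⧸ (I + (x))` (third isomorphism theorem,
principal case). [folklore] -/
theorem schonResolves_nonempty_quotQuotMk_ringEquiv {A : Type} [CommRing A] (I : Ideal A) (x : A) :
    Nonempty (((A ⧸ I) ⧸ Ideal.span {Ideal.Quotient.mk I x}) ≃+* A ⧸ (I ⊔ Ideal.span {x})) := by
  have hmap : Ideal.span {Ideal.Quotient.mk I x} = (Ideal.span {x}).map (Ideal.Quotient.mk I) := by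
    rw [Ideal.map_span, Set.image_singleton]
  exact ⟨(Ideal.quotEquivOfEq hmap).trans (DoubleQuot.quotQuotEquivQuotSup I (Ideal.span {x}))⟩

/-- Transport of a Krull dimension along a ring isomorphism out of a principal quotient (stated
for an abstract ring so that the quotient's instances are the canonical ones). [folklore] -/
theorem schonResolves_ringKrullDim_eq_of_quotient_span_ringEquiv {A : Type} [CommRing A] (x : A)
    {T : Type} [CommRing T] (e : (A ⧸ Ideal.span {x}) ≃+* T) {d : WithBot ℕ∞}
    (h : ringKrullDim (A ⧸ Ideal.span {x}) = d) : ringKrullDim T = d := by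
  rw [← ringKrullDim_eq_of_ringEquiv e]
  exact h

/-- The shear `ψ_φ : ℤ × M ≃ ℤ × M`, `(a, u) ↦ (a + φ u, u)`, of the exponent lattice of
`k[t^±][M]` exists for every additive weight `φ : M →+ ℤ`. [folklore] -/
theorem schonResolves_exists_shear {M : Type} [AddCommGroup M] (φ : M →+ ℤ) :
    ∃ ψ : ℤ × M ≃+ ℤ × M, ∀ (a : ℤ) (u : M), ψ (a, u) = (a + φ u, u) := by
  refine ⟨{ toFun := fun p => (p.1 + φ p.2, p.2)
            invFun := fun p => (p.1 - φ p.2, p.2)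
            left_inv := fun p => by simp
            right_inv := fun p => by simp
            map_add' := fun p q => ?_ }, fun a u => rfl⟩
  ext
  · simp only [Prod.fst_add, Prod.snd_add, map_add]
    abel
  · simp only [Prod.snd_add]

/-- **The dimension of an initial degeneration of an integral very affine variety equals the
dimension of the variety** (registered stub DIM of crux `SchonResolves`, line `zariski-toric-closure`).
For a prime ideal `I ⊆ k[ℤ^n]` over a field `k` with `dim k[ℤ^n] ⧸ I = d` and a weight `w ∈ ℤ^n`
with `in_w(I) ≠ ⊤` (i.e. `w ∈ Trop V(I)`), `dim k[ℤ^n] ⧸ in_w(I) = d`. Proof through the Gröbner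
family (module docstring): an affine domain `A_t` of dimension `d + 1` with `A_t[t̄⁻¹] ≅ (k[ℤ^n] ⧸ I)[t^±]`
and `A_t ⧸ (t̄) ≅ k[ℤ^n] ⧸ in_w(I)`, `t̄ ≠ 0` a non-unit.
[cite: MaclaganSturmfels2015, §3.2 (Gröbner degenerations preserve dimension)] -/
theorem schonResolves_ringKrullDim_quotient_weightInitialIdeal :
    ∀ (k : Type) [Field k] (n : ℕ) (I : Ideal (AddMonoidAlgebra k (Fin n → ℤ))), I.IsPrime → ∀ (d : ℕ), ringKrullDim (AddMonoidAlgebra k (Fin n → ℤ) ⧸ I) = (d : WithBot ℕ∞) → ∀ (w : Fin n → ℤ), Literature.AlgebraicGeometry.Tropical.weightInitialIdeal w I ≠ ⊤ → ringKrullDim (AddMonoidAlgebra k (Fin n → ℤ) ⧸ Literature.AlgebraicGeometry.Tropical.weightInitialIdeal w I) = (d : WithBot ℕ∞) := by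
  intro k _ n I hI d hdim w hw
  classical
  -- the shear and the sheared extension `J ⊆ k[ℤ × ℤ^n]` of `I`
  obtain ⟨ψ, hψ⟩ := schonResolves_exists_shear (dotWeightHom w)
  obtain ⟨J, hJ⟩ : ∃ J : Ideal (AddMonoidAlgebra k (ℤ × (Fin n → ℤ))),
      J = (I.map (mapDomainRingHom k (AddMonoidHom.inr ℤ (Fin n → ℤ)))).map (domCongr k k ψ) :=
    ⟨_, rfl⟩
  have hin : weightInitialIdeal w I = initialIdeal (dotWeightHom w) I := by
    rw [weightInitialIdeal, coe_dotWeightHom]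
  rw [hin] at hw ⊢
  -- (1) the generic fibre `k[ℤ × ℤ^n] ⧸ J ≃ (k[ℤ^n] ⧸ I)[ℤ]`: an affine domain of dimension `d + 1`
  obtain ⟨e₂⟩ := schonResolves_quotient_map_inr_algEquiv k (Fin n → ℤ) I
  have e₁ : (AddMonoidAlgebra k (ℤ × (Fin n → ℤ)) ⧸
      I.map (mapDomainRingHom k (AddMonoidHom.inr ℤ (Fin n → ℤ)))) ≃ₐ[k]
        AddMonoidAlgebra k (ℤ × (Fin n → ℤ)) ⧸ J :=
    Ideal.quotientEquivAlg _ _ (domCongr k k ψ) hJ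
  have eJ := e₁.symm.trans e₂
  haveI : IsDomain (AddMonoidAlgebra k (Fin n → ℤ) ⧸ I) := (Ideal.Quotient.isDomain_iff_prime I).2 hI
  haveI : IsDomain (AddMonoidAlgebra k (ℤ × (Fin n → ℤ)) ⧸ J) := MulEquiv.isDomain _ eJ.toMulEquiv
  haveI hJprime : J.IsPrime := (Ideal.Quotient.isDomain_iff_prime J).1 inferInstance
  haveI : Algebra.FiniteType k (AddMonoidAlgebra k (Fin n → ℤ) ⧸ I) :=
    Algebra.FiniteType.of_surjective (Ideal.Quotient.mkₐ k I) Ideal.Quotient.mk_surjective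
  have hdimJ : ringKrullDim (AddMonoidAlgebra k (ℤ × (Fin n → ℤ)) ⧸ J) = ((d + 1 : ℕ) : WithBot ℕ∞) := by
    rw [ringKrullDim_eq_of_ringEquiv
      (S := AddMonoidAlgebra (AddMonoidAlgebra k (Fin n → ℤ) ⧸ I) ℤ) eJ.toRingEquiv]
    exact schonResolves_ringKrullDim_laurent_of_finiteType k _ d hdim
  -- (2) the total space `A_t = k[ℕ × ℤ^n] ⧸ (J ∩ k[ℕ × ℤ^n])` of the Gröbner family
  haveI : (linkIdeal ((Nat.castAddMonoidHom ℤ).prodMap (AddMonoidHom.id (Fin n → ℤ))) J).IsPrime :=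
    inferInstance
  haveI : IsDomain (AddMonoidAlgebra k (ℕ × (Fin n → ℤ)) ⧸
      linkIdeal ((Nat.castAddMonoidHom ℤ).prodMap (AddMonoidHom.id (Fin n → ℤ))) J) :=
    (Ideal.Quotient.isDomain_iff_prime _).2 inferInstance
  haveI : Algebra.FiniteType k (AddMonoidAlgebra k (ℕ × (Fin n → ℤ)) ⧸
      linkIdeal ((Nat.castAddMonoidHom ℤ).prodMap (AddMonoidHom.id (Fin n → ℤ))) J) :=
    Algebra.FiniteType.of_surjective (Ideal.Quotient.mkₐ k _) Ideal.Quotient.mk_surjective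
  -- its localization away from `t̄` is the generic fibre
  letI alg : Algebra (AddMonoidAlgebra k (ℕ × (Fin n → ℤ)) ⧸
      linkIdeal ((Nat.castAddMonoidHom ℤ).prodMap (AddMonoidHom.id (Fin n → ℤ))) J)
      (AddMonoidAlgebra k (ℤ × (Fin n → ℤ)) ⧸ J) :=
    (Ideal.quotientMap J (mapDomainRingHom k
      ((Nat.castAddMonoidHom ℤ).prodMap (AddMonoidHom.id (Fin n → ℤ)))) le_rfl).toAlgebra
  have halg : (algebraMap (AddMonoidAlgebra k (ℕ × (Fin n → ℤ)) ⧸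
      linkIdeal ((Nat.castAddMonoidHom ℤ).prodMap (AddMonoidHom.id (Fin n → ℤ))) J)
      (AddMonoidAlgebra k (ℤ × (Fin n → ℤ)) ⧸ J)).comp (Ideal.Quotient.mk _) =
      (Ideal.Quotient.mk J).comp (mapDomainRingHom k
        ((Nat.castAddMonoidHom ℤ).prodMap (AddMonoidHom.id (Fin n → ℤ)))) :=
    RingHom.ext fun b => rfl
  haveI hloc := schonResolves_isLocalization_away_quotient J halg
  -- `t̄ ≠ 0`: otherwise the unit `t` lies in `J` and the generic fibre is the zero ring
  have ht0 : Ideal.Quotient.mk (linkIdeal ((Nat.castAddMonoidHom ℤ).prodMap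
      (AddMonoidHom.id (Fin n → ℤ))) J) (single ((1 : ℕ), (0 : Fin n → ℤ)) (1 : k)) ≠ 0 := by
    intro h0
    rw [Ideal.Quotient.eq_zero_iff_mem, mem_linkIdeal_iff, mapDomain_single] at h0
    have hJtop : J = ⊤ := Ideal.eq_top_of_isUnit_mem _ h0 (isUnit_single isUnit_one _)
    exact hJprime.ne_top hJtop
  have hdimA : ringKrullDim (AddMonoidAlgebra k (ℕ × (Fin n → ℤ)) ⧸
      linkIdeal ((Nat.castAddMonoidHom ℤ).prodMap (AddMonoidHom.id (Fin n → ℤ))) J) =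
      ((d + 1 : ℕ) : WithBot ℕ∞) := by
    rw [← schonResolves_ringKrullDim_away_eq_of_finiteType k _ _ ht0
      (AddMonoidAlgebra k (ℤ × (Fin n → ℤ)) ⧸ J), hdimJ]
  -- (3) the special fibre `A_t ⧸ (t̄) ≅ k[ℕ × ℤ^n] ⧸ (J_B + (t)) ≅ k[ℤ^n] ⧸ in_w(I)`
  obtain ⟨e₃⟩ := schonResolves_nonempty_quotQuotMk_ringEquiv
    (linkIdeal ((Nat.castAddMonoidHom ℤ).prodMap (AddMonoidHom.id (Fin n → ℤ))) J)
    (single ((1 : ℕ), (0 : Fin n → ℤ)) (1 : k))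
  obtain ⟨e₄⟩ := schonResolves_nonempty_quotient_sup_span_ringEquiv (k := k) (K := Fin n → ℤ)
    (linkIdeal ((Nat.castAddMonoidHom ℤ).prodMap (AddMonoidHom.id (Fin n → ℤ))) J)
  have hfib : linkIdeal (AddMonoidHom.inr ℕ (Fin n → ℤ))
      (linkIdeal ((Nat.castAddMonoidHom ℤ).prodMap (AddMonoidHom.id (Fin n → ℤ))) J ⊔
        Ideal.span {single ((1 : ℕ), (0 : Fin n → ℤ)) (1 : k)}) = initialIdeal (dotWeightHom w) I := by
    rw [hJ]
    exact schonResolves_grobnerFamily_fibreIdeal_eq_initialIdeal k (Fin n → ℤ) (dotWeightHom w) ψ hψ I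
  have e₅ := e₃.trans (e₄.symm.trans (Ideal.quotEquivOfEq hfib))
  -- `t̄` is not a unit: the special fibre is not the zero ring
  have htu : ¬ IsUnit (Ideal.Quotient.mk (linkIdeal ((Nat.castAddMonoidHom ℤ).prodMap
      (AddMonoidHom.id (Fin n → ℤ))) J) (single ((1 : ℕ), (0 : Fin n → ℤ)) (1 : k))) := by
    intro hu
    have hsub : Subsingleton (AddMonoidAlgebra k (Fin n → ℤ) ⧸ initialIdeal (dotWeightHom w) I) := by
      haveI : Subsingleton ((AddMonoidAlgebra k (ℕ × (Fin n → ℤ)) ⧸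
          linkIdeal ((Nat.castAddMonoidHom ℤ).prodMap (AddMonoidHom.id (Fin n → ℤ))) J) ⧸
            Ideal.span {Ideal.Quotient.mk (linkIdeal ((Nat.castAddMonoidHom ℤ).prodMap
              (AddMonoidHom.id (Fin n → ℤ))) J) (single ((1 : ℕ), (0 : Fin n → ℤ)) (1 : k))}) :=
        Ideal.Quotient.subsingleton_iff.2 (Ideal.eq_top_of_isUnit_mem _ (Ideal.mem_span_singleton_self _) hu)
      exact e₅.symm.toEquiv.subsingleton
    exact hw (Ideal.Quotient.subsingleton_iff.1 hsub)
  -- (4) conclude: hypersurface sections of affine domains drop the dimension by one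
  exact schonResolves_ringKrullDim_eq_of_quotient_span_ringEquiv _ e₅
    (schonResolves_ringKrullDim_quotient_span_singleton_of_isDomain k _ d hdimA _ ht0 htu)

end Summit.ResolutionOfSingularities.ResolutionOfSingularities.Theorems
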